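import Literature.NumberTheory.Sieve.LargeSieveInequality
import Literature.NumberTheory.Sieve.FriedlanderIwaniecPrimes
import HarnessLib

/-!
# Friedlander–Iwaniec, *The polynomial `X² + Y⁴` captures its primes*, Lemma 3.2: the large sieve at the roots of `ν² + 1 ≡ 0 (mod d)` (proof)

Family `parity`, statement parity.S17. Source: J. Friedlander, H. Iwaniec, Ann. of Math. (2) 148
(1998), 945–1040 [FriedlanderIwaniecAnnals1998] (= arXiv:math/9811185), §3, from "The proof of
Lemma 3.1 requires an application of harmonic analysis and it rests on the fact that there is an
exceptional well-spacing property of the rationals `ν/d (mod 1)` with `ν` ranging over the roots of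
`ν² + 1 ≡ 0 (mod d)`" to Lemma 3.2 (pp. 955–956 of the journal = pp. 10–11 of the arXiv version).

FI Lemma 3.2 is the first input of FI Lemma 3.1 (the named fact
`Literature.NumberTheory.Sieve.FriedlanderIwaniec1998_lemma31` of `FriedlanderIwaniecPrimesMainTerm`, on which
Proposition 3.5 and hence hypothesis (2.9) of Theorem 1 rest, `FriedlanderIwaniecPrimesMainTermProofs`):
(3.6) and Lemma 3.3 are deduced from it by Cauchy's inequality and the reduction (3.9), and
Lemma 3.1 from Lemma 3.3 by Poisson summation ((3.10)–(3.13)). This file PROVES Lemma 3.2, with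
an explicit absolute constant:

* `largeSieve_quadraticRoots`: for all complex `a_n` on a window `M₀ < n ≤ M₀ + N` and all `D`,
  `Σ_{D < d ≤ 2D} Σ_{ν mod d, ν² + 1 ≡ 0} |Σ_n a_n e(νn/d)|² ≤ 68 (D + N) Σ_n |a_n|²`
  (FI: "`≪ (D + N)‖α‖²` ... the implied constant is absolute");

and its consequence (3.6) ("By Cauchy's inequality Lemma 3.2 yields ..."), the form in which it
enters the proof of Lemma 3.3:

* `sum_roots_norm_le`: `Σ_{d ≤ D} Σ_{ν} |Σ_n a_n e(νn/d)| ≤ 190 D^{1/2} (D + N)^{1/2} (Σ_n |a_n|²)^{1/2}`,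
  together with the root count `card_sigma_roots_le`: `Σ_{d ≤ X} ρ(d) = #{(d, ν) : d ≤ X} ≤ 11 X`.

## The argument (FI §3, made effective)

* `exists_primitive_rep`: for `d ≥ 3`, every root `ν` comes from a primitive representation
  `d = r² + s²`, `(r, s) = 1`, `0 < |r| < s`, through `ν s ≡ r (mod d)` (FI: "each such
  representation gives the unique root defined by `νs ≡ r (mod d)`"; we need the converse, which
  FI take for granted: by Thue's lemma (`exists_small_sol_congr`, pigeonhole on
  `(u, v) ↦ u - νv mod d` over `0 ≤ u, v ≤ √d`) there is `(a, b) ≠ 0` with `a ≡ νb`, `a², b² ≤ d`,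
  so `a² + b² ∈ {d, 2d}`; `2d` forces `d ∣ 4` (`not_four_dvd_sq_add_one`), and a common divisor
  `g` of `a, b` has `g (d/g²) ∣ d/g²`; the four rotations of `(a, b)` all satisfy the congruence).
* `root_spacing` (FI's display before Lemma 3.2): with `k = (νs - r)/d` one has
  `ν/d = r/(sd) + k/s`, `k r ≡ -1 (mod s)` (`isCoprime_of_rep`), `|r|/(sd) ≤ 1/(2s²)`; for two
  roots with `r` of the same sign and `2s₁ ≤ 3s₂`, `2s₂ ≤ 3s₁`, either
  `k₂/s₂ - k₁/s₁ - m = K/(s₁s₂)` with `K ≠ 0`, giving `|ν₂/d₂ - ν₁/d₁ - m| ≥ 1/(s₁s₂) - 3/(4s₁s₂)`,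
  or `K = 0`, and then `s₁ = s₂`, `r₁ ≡ r₂ (mod s)`, `r₁ = r₂`, `d₁ = d₂`, `ν₁ = ν₂`.
* `root_spacing_class`: for `D < d ≤ 2D` one has `D < d ≤ 2s²`, `s² ≤ d ≤ 2D`, so within each of
  the classes {`8s² ≤ 9D`}, {`8s² > 9D`} the ratio conditions hold and `s₁s₂ ≤ 2D`: the points of
  one class (same sign of `r`, same range of `s`) are `1/(8D)`-spaced. (FI confine `d` to
  `(8D/9, D]` instead and get `1/(4D)`.)
* `largeSieve_quadraticRoots`: the large sieve inequality for `δ`-spaced points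
  (`Literature.NumberTheory.Sieve.LargeSieve.largeSieve_wellSpaced`, Davenport–Halberstam [DH] in FI; the tree's
  version is Bombieri's, constant `N + 1 + 2δ⁻¹`) on each of the four classes gives
  `4 (N + 1 + 16D) ≤ 68 (D + N)` for `D ≥ 2`; `D ≤ 1` is trivial (at most the point `1/2`).
* `card_sigma_roots_le`: `(d, ν) ↦ (r, s)` is injective (`eq_of_rep_eq`) into the box
  `|r|, |s| ≤ √X`, so `#{(d, ν) : 3 ≤ d ≤ X} ≤ (2√X + 1)²`, plus two points with `d ≤ 2`.
* `sum_roots_norm_le` ((3.6)): on the block `X/2 < d ≤ X` (covered by the two ranges `(M, 2M]`,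
  `(M + 1, 2M + 2]`, `M = ⌊X/2⌋`, of Lemma 3.2) Cauchy's inequality gives
  `≤ (11X)^{1/2} (136 (X + N + 1) ‖a‖²)^{1/2} ≤ 39 X^{1/2} (X + N + 1)^{1/2} ‖a‖`, and induction over
  the dyadic blocks (`134/√2 + 39 ≤ 134`) gives `134 X^{1/2} (X + N + 1)^{1/2} ‖a‖`; the modulus
  `d = 1` (root `0`) contributes `≤ N^{1/2} ‖a‖`; finally `134 √2 ≤ 190`.

## References

* J. Friedlander, H. Iwaniec, *The polynomial `X² + Y⁴` captures its primes*, Ann. of Math. (2)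
  148 (1998), 945–1040, §3, Lemma 3.2 and the preceding discussion. [cite: FriedlanderIwaniecAnnals1998, Lemma 3.2 and (3.6)]
* H. Davenport, H. Halberstam, *The values of a trigonometric polynomial at well spaced points*,
  Mathematika 13 (1966), 91–96 (FI's [DH]; here replaced by the tree's `largeSieve_wellSpaced`).
* E. Fouvry, H. Iwaniec, *Gaussian primes*, Acta Arith. 79 (1997), 249–287 (FI's [FI], where the
  spacing argument originates).

## Mathlib / tree

Tree: `Literature.NumberTheory.Sieve.LargeSieve.e`, `largeSieve_wellSpaced` (`LargeSieveInequality`), `fiRho`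
(`FriedlanderIwaniecPrimes`). Mathlib: `Finset.exists_ne_map_eq_of_card_lt_of_maps_to`
(pigeonhole), `Nat.lt_succ_sqrt`, `Int.isCoprime_iff_gcd_eq_one`, `IsCoprime.dvd_of_dvd_mul_left`,
`IsCoprime.isUnit_of_dvd'`, `Int.eq_zero_of_abs_lt_dvd`, `Finset.sum_fiberwise_of_maps_to`,
`Finset.card_le_card_of_injOn`, `Finset.sum_mul_sq_le_sq_mul_sq` (Cauchy), `Finset.sum_Ioc_consecutive`,
`Nat.strong_induction_on`. No definitions are introduced (the root set is written
`{ν ∈ range d | d ∣ ν² + 1}`, whose cardinality is the tree's `fiRho d` by `rfl`).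
-/

noncomputable section

open Finset Real Complex
open scoped ComplexConjugate FourierTransform

namespace Literature.NumberTheory.Sieve.FriedlanderIwaniecPrimes

open LargeSieve

/-! ### Thue's lemma: a small solution of `a ≡ ν b (mod d)` -/

/-- **Thue's lemma** (pigeonhole): for `d ≥ 1` and any `ν` there are integers `a, b`, not both
zero, with `a² ≤ d`, `b² ≤ d` and `a ≡ ν b (mod d)`. [folklore] -/
theorem exists_small_sol_congr {d : ℕ} (hd : 0 < d) (ν : ℤ) :
    ∃ a b : ℤ, (a ≠ 0 ∨ b ≠ 0) ∧ a ^ 2 ≤ d ∧ b ^ 2 ≤ d ∧ (d : ℤ) ∣ a - ν * b := by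
  set m := Nat.sqrt d with hm
  set S : Finset (ℕ × ℕ) := range (m + 1) ×ˢ range (m + 1) with hS
  have hdz : (0 : ℤ) < d := by exact_mod_cast hd
  set f : ℕ × ℕ → ℕ := fun uv => (((uv.1 : ℤ) - ν * uv.2) % d).toNat with hf
  have hmaps : ∀ uv ∈ S, f uv ∈ range d := by
    intro uv _
    rw [mem_range]
    have h1 : 0 ≤ ((uv.1 : ℤ) - ν * uv.2) % d := Int.emod_nonneg _ hdz.ne'
    have h2 : ((uv.1 : ℤ) - ν * uv.2) % d < d := Int.emod_lt_of_pos _ hdz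
    have : ((f uv : ℕ) : ℤ) < d := by rw [hf]; simp only; rw [Int.toNat_of_nonneg h1]; exact h2
    exact_mod_cast this
  have hcard : #(range d) < #S := by
    rw [card_range, hS, card_product, card_range]
    exact Nat.lt_succ_sqrt d
  obtain ⟨x, hx, y, hy, hxy, hfxy⟩ := exists_ne_map_eq_of_card_lt_of_maps_to hcard hmaps
  refine ⟨(x.1 : ℤ) - y.1, (x.2 : ℤ) - y.2, ?_, ?_, ?_, ?_⟩
  · by_contra h
    simp only [not_or, ne_eq, not_not] at h
    apply hxy
    have h1 : x.1 = y.1 := by have := h.1; omega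
    have h2 : x.2 = y.2 := by have := h.2; omega
    exact Prod.ext h1 h2
  · have hx1 := mem_range.mp (mem_product.mp hx).1
    have hy1 := mem_range.mp (mem_product.mp hy).1
    have hm2 : ((m : ℤ)) ^ 2 ≤ d := by exact_mod_cast Nat.sqrt_le' d
    have : ((x.1 : ℤ) - y.1) ^ 2 ≤ (m : ℤ) ^ 2 := sq_le_sq' (by omega) (by omega)
    linarith
  · have hx2 := mem_range.mp (mem_product.mp hx).2
    have hy2 := mem_range.mp (mem_product.mp hy).2
    have hm2 : ((m : ℤ)) ^ 2 ≤ d := by exact_mod_cast Nat.sqrt_le' d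
    have : ((x.2 : ℤ) - y.2) ^ 2 ≤ (m : ℤ) ^ 2 := sq_le_sq' (by omega) (by omega)
    linarith
  · -- equal residues
    have h1 : 0 ≤ ((x.1 : ℤ) - ν * x.2) % d := Int.emod_nonneg _ hdz.ne'
    have h2 : 0 ≤ ((y.1 : ℤ) - ν * y.2) % d := Int.emod_nonneg _ hdz.ne'
    have heq : ((x.1 : ℤ) - ν * x.2) % d = ((y.1 : ℤ) - ν * y.2) % d := by
      have := congrArg (fun n : ℕ => (n : ℤ)) hfxy
      simpa only [hf, Int.toNat_of_nonneg h1, Int.toNat_of_nonneg h2] using this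
    have := Int.ModEq.dvd heq.symm
    -- `d ∣ (x₁ - ν x₂) - (y₁ - ν y₂)`
    rw [show (x.1 : ℤ) - y.1 - ν * ((x.2 : ℤ) - y.2) = ((x.1 : ℤ) - ν * x.2) - ((y.1 : ℤ) - ν * y.2) by ring]
    exact this

/-- `ν² + 1 ≡ 0 (mod 4)` is impossible. [folklore] -/
theorem not_four_dvd_sq_add_one (ν : ℤ) : ¬ (4 : ℤ) ∣ ν ^ 2 + 1 := by
  intro h
  have h1 : ((ν ^ 2 + 1 : ℤ) : ZMod 4) = 0 := (ZMod.intCast_zmod_eq_zero_iff_dvd _ 4).mpr h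
  push_cast at h1
  exact absurd h1 (by revert h1; generalize (ν : ZMod 4) = z; intro h1; revert z; decide)

/-! ### Primitive representations `d = r² + s²` attached to a root `ν` -/

/-- For `d ≥ 3` and a root `ν` of `ν² + 1 ≡ 0 (mod d)` there are coprime integers `r, s` with
`d = r² + s²`, `0 < |r| < s` and `ν s ≡ r (mod d)` (FI §3: "each such representation gives the
unique root defined by `ν s ≡ r (mod d)`"; here the converse direction, obtained from Thue's lemma:
a small solution of `a ≡ ν b` has `a² + b² ≡ 0`, `0 < a² + b² ≤ 2d`, and `a² + b² = 2d` as well as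
`(a, b) > 1` are impossible). [cite: FriedlanderIwaniecAnnals1998, §3, before Lemma 3.2] -/
theorem exists_primitive_rep {d : ℕ} (hd : 3 ≤ d) {ν : ℤ} (hν : (d : ℤ) ∣ ν ^ 2 + 1) :
    ∃ r s : ℤ, r ^ 2 + s ^ 2 = d ∧ IsCoprime r s ∧ 0 < s ∧ |r| < s ∧ r ≠ 0 ∧
      (d : ℤ) ∣ ν * s - r := by
  have hd0 : 0 < d := by omega
  have hdz : (0 : ℤ) < d := by exact_mod_cast hd0
  obtain ⟨a, b, hab0, ha2, hb2, hdvd⟩ := exists_small_sol_congr hd0 ν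
  -- `d ∣ a² + b²`
  have hsum : (d : ℤ) ∣ a ^ 2 + b ^ 2 := by
    have : a ^ 2 + b ^ 2 = (a - ν * b) * (a + ν * b) + (ν ^ 2 + 1) * b ^ 2 := by ring
    rw [this]
    exact (hdvd.mul_right _).add (hν.mul_right _)
  have hpos : 0 < a ^ 2 + b ^ 2 := by
    rcases hab0 with ha | hb
    · have := pow_pos (abs_pos.mpr ha) 2; rw [pow_abs] at this; positivity
    · have := pow_pos (abs_pos.mpr hb) 2; rw [pow_abs] at this; positivity
  obtain ⟨q, hq⟩ := hsum
  have hq1 : q = 1 := by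
    have hq0 : 0 < q := by
      by_contra h
      have h' : q ≤ 0 := not_lt.mp h
      have : (d : ℤ) * q ≤ 0 := mul_nonpos_of_nonneg_of_nonpos hdz.le h'
      linarith
    have hq2 : q ≤ 2 := by
      by_contra h
      have h' : 3 ≤ q := by have := not_le.mp h; omega
      have : (d : ℤ) * 3 ≤ d * q := mul_le_mul_of_nonneg_left h' hdz.le
      linarith
    interval_cases q
    · rfl
    · -- `a² + b² = 2d` forces `a² = b² = d`, then `a ∣ 2`, `d ∣ 4`: impossible for `d ≥ 3`
      exfalso
      have ha : a ^ 2 = d := by linarith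
      have hb : b ^ 2 = d := by linarith
      have ha0 : a ≠ 0 := by rintro rfl; simp at ha; omega
      -- `b = ± a`
      have hba : b = a ∨ b = -a := by
        have : b ^ 2 = a ^ 2 := by rw [ha, hb]
        exact sq_eq_sq_iff_eq_or_eq_neg.mp this  -- name?
      -- `a² ∣ a - ν b = a (1 ∓ ν)` ⇒ `a ∣ 1 ∓ ν` ⇒ `a ∣ 1 - ν²`
      have hdvd' : a ^ 2 ∣ a - ν * b := by rw [ha]; exact hdvd
      have h1 : a ∣ 1 - ν ^ 2 := by
        rcases hba with hba | hba
        · rw [hba] at hdvd'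
          have : a * a ∣ a * (1 - ν) := by rw [← sq]; convert hdvd' using 1; ring
          have h2 : a ∣ 1 - ν := (mul_dvd_mul_iff_left ha0).mp this
          have : 1 - ν ^ 2 = (1 - ν) * (1 + ν) := by ring
          rw [this]; exact h2.mul_right _
        · rw [hba] at hdvd'
          have : a * a ∣ a * (1 + ν) := by rw [← sq]; convert hdvd' using 1; ring
          have h2 : a ∣ 1 + ν := (mul_dvd_mul_iff_left ha0).mp this
          have : 1 - ν ^ 2 = (1 + ν) * (1 - ν) := by ring
          rw [this]; exact h2.mul_right _
      have h2 : a ∣ ν ^ 2 + 1 := (Dvd.intro_left _ (sq a).symm).trans (ha ▸ hν)  -- a ∣ a² = d ∣ ν²+1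
      have h3 : a ∣ 2 := by
        have := h1.add h2
        rwa [show 1 - ν ^ 2 + (ν ^ 2 + 1) = (2 : ℤ) by ring] at this
      have h4 : a ^ 2 ∣ 4 := by
        have := pow_dvd_pow_of_dvd h3 2
        simpa using this
      -- so `d ∣ 4`, `d ≥ 3` ⇒ `d = 4`, but `4 ∤ ν² + 1`
      rw [ha] at h4
      have hd4 : d ∣ 4 := by exact_mod_cast h4
      have hd4' : d = 4 := by
        have := Nat.le_of_dvd (by norm_num) hd4
        interval_cases d <;> simp_all
      subst hd4'
      exact not_four_dvd_sq_add_one ν (by exact_mod_cast hν)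
  subst hq1
  rw [mul_one] at hq
  -- `hq : a² + b² = d`. Primitivity.
  have hcop : IsCoprime a b := by
    rw [Int.isCoprime_iff_gcd_eq_one]
    set g := Int.gcd a b with hg
    have hg0 : 0 < g := Int.gcd_pos_iff.mpr hab0
    obtain ⟨a', ha'⟩ := Int.gcd_dvd_left a b
    obtain ⟨b', hb'⟩ := Int.gcd_dvd_right a b
    rw [← hg] at ha' hb'
    set e := a' ^ 2 + b' ^ 2 with he
    have hde : (d : ℤ) = (g : ℤ) ^ 2 * e := by rw [← hq, ha', hb', he]; ring
    have hgz : (0 : ℤ) < g := by exact_mod_cast hg0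
    have he0 : 0 < e := by
      have : 0 < (g : ℤ) ^ 2 * e := by rw [← hde]; exact hdz
      exact pos_of_mul_pos_right this (by positivity)  -- name? (0 < a*b, 0 ≤ a → 0 < b)
    -- `g e ∣ a' - ν b'`
    have h1 : (g : ℤ) * e ∣ a' - ν * b' := by
      have : (g : ℤ) * ((g : ℤ) * e) ∣ (g : ℤ) * (a' - ν * b') := by
        have h' : (d : ℤ) ∣ a - ν * b := hdvd
        rw [hde, ha', hb'] at h'
        convert h' using 1 <;> ring
      exact (mul_dvd_mul_iff_left hgz.ne').mp this
    -- `g e ∣ (ν² + 1) b'²`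
    have h2 : (g : ℤ) * e ∣ (ν ^ 2 + 1) * b' ^ 2 := by
      have : (g : ℤ) * e ∣ d := ⟨g, by rw [hde]; ring⟩
      exact (this.trans hν).mul_right _
    -- hence `g e ∣ e`
    have h3 : (g : ℤ) * e ∣ e := by
      have h1' := h1.mul_right (a' + ν * b')
      have := h1'.add h2
      rwa [show (a' - ν * b') * (a' + ν * b') + (ν ^ 2 + 1) * b' ^ 2 = e by rw [he]; ring] at this
    have h4 : (g : ℤ) * e ≤ 1 * e := by rw [one_mul]; exact Int.le_of_dvd he0 h3
    have h5 : (g : ℤ) ≤ 1 := le_of_mul_le_mul_right h4 he0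
    have : g ≤ 1 := by exact_mod_cast h5
    omega
  -- congruences for the rotations
  have H0 : (d : ℤ) ∣ ν * b - a := by
    have := hdvd.neg_right; rwa [show -(a - ν * b) = ν * b - a by ring] at this
  have H1 : (d : ℤ) ∣ ν * a + b := by
    have : ν * a + b = ν * (a - ν * b) + (ν ^ 2 + 1) * b := by ring
    rw [this]; exact (hdvd.mul_left ν).add (hν.mul_right b)
  -- normalise: `s > 0`, `|r| ≤ s`
  have key : ∃ r s : ℤ, r ^ 2 + s ^ 2 = d ∧ IsCoprime r s ∧ 0 < s ∧ |r| ≤ s ∧ (d : ℤ) ∣ ν * s - r := by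
    rcases le_or_gt |a| |b| with hle | hlt
    · have hb0 : b ≠ 0 := by
        rintro rfl
        simp at hle
        exact hab0.elim (fun h => h hle) (fun h => h rfl)
      rcases lt_or_gt_of_ne hb0 with hbneg | hbpos
      · refine ⟨-a, -b, by rw [← hq]; ring, hcop.neg_left.neg_right, by linarith, ?_, ?_⟩
        · rw [abs_neg]; rw [abs_of_neg hbneg] at hle; exact hle
        · rw [show ν * -b - -a = -(ν * b - a) by ring]; exact H0.neg_right
      · refine ⟨a, b, hq, hcop, hbpos, ?_, H0⟩
        rw [abs_of_pos hbpos] at hle; exact hle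
    · have ha0 : a ≠ 0 := by
        rintro rfl
        rw [abs_zero] at hlt
        exact absurd hlt (abs_nonneg b).not_gt
      rcases lt_or_gt_of_ne ha0 with haneg | hapos
      · refine ⟨b, -a, by rw [← hq]; ring, hcop.symm.neg_right, by linarith, ?_, ?_⟩
        · rw [abs_of_neg haneg] at hlt; exact hlt.le
        · rw [show ν * -a - b = -(ν * a + b) by ring]; exact H1.neg_right
      · refine ⟨-b, a, by rw [← hq]; ring, hcop.symm.neg_left, hapos, ?_, ?_⟩
        · rw [abs_neg]; rw [abs_of_pos hapos] at hlt; exact hlt.le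
        · rw [show ν * a - -b = ν * a + b by ring]; exact H1
  obtain ⟨r, s, hrs, hcop', hs0, hle, hdiv⟩ := key
  -- `s ≥ 2` (as `2 s² ≥ d ≥ 3`), so `|r| < s` and `r ≠ 0` by coprimality
  have hs2 : 2 ≤ s := by
    by_contra h
    have hs1 : s = 1 := by have := not_le.mp h; omega
    subst hs1
    have : |r| ≤ 1 := hle
    have hr2 : r ^ 2 ≤ 1 := by
      have := abs_le.mp this
      nlinarith
    have : (d : ℤ) ≤ 2 := by rw [← hrs]; linarith
    have : d ≤ 2 := by exact_mod_cast this
    omega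
  refine ⟨r, s, hrs, hcop', hs0, ?_, ?_, hdiv⟩
  · rcases hle.lt_or_eq with hlt | heq
    · exact hlt
    · exfalso
      -- `|r| = s`: then `s ∣ r`, coprimality forces `s` to be a unit
      have hsr : s ∣ r := by
        rcases abs_choice r with h | h
        · exact ⟨1, by rw [mul_one, ← h, heq]⟩
        · exact ⟨-1, by linarith [h.symm.trans heq]⟩  -- r = -|r| = -s
      have hu : IsUnit s := hcop'.isUnit_of_dvd' hsr dvd_rfl
      rcases Int.isUnit_iff.mp hu with h | h <;> omega
  · rintro rfl
    have hu : IsUnit s := isCoprime_zero_left.mp hcop'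
    rcases Int.isUnit_iff.mp hu with h | h <;> omega

/-! ### The spacing of the points `ν/d` -/

/-- From `ν s ≡ r (mod d)`, `d = r² + s²`, `(r, s) = 1`: the integer `k = (ν s - r)/d` satisfies
`k r ≡ -1 (mod s)`, so `(k, s) = 1` (this is FI's `ν/d ≡ r/(sd) - r̄/s (mod 1)`).
[cite: FriedlanderIwaniecAnnals1998, §3, the displays before Lemma 3.2] -/
theorem isCoprime_of_rep {d : ℕ} {ν : ℕ} {r s k : ℤ} (h : r ^ 2 + s ^ 2 = d)
    (hc : IsCoprime r s) (hk : (ν : ℤ) * s - r = d * k) : IsCoprime k s := by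
  -- `r (k r + 1) = s (ν - k s)`
  have h1 : r * (k * r + 1) = s * (ν - k * s) := by
    have : (d : ℤ) = r ^ 2 + s ^ 2 := h.symm
    rw [this] at hk
    linear_combination -hk
  have h2 : s ∣ k * r + 1 := by
    have : s ∣ r * (k * r + 1) := ⟨ν - k * s, h1⟩
    exact hc.symm.dvd_of_dvd_mul_left this
  obtain ⟨t, ht⟩ := h2
  exact ⟨-r, t, by linear_combination -ht⟩

/-- **FI's spacing property of the roots.** Let `d_i = r_i² + s_i²` (`i = 1, 2`) with
`(r_i, s_i) = 1`, `0 < |r_i| < s_i`, `r₁, r₂` of the same sign, `2s₁ ≤ 3s₂`, `2s₂ ≤ 3s₁`, and let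
`ν_i (mod d_i)` satisfy `ν_i s_i ≡ r_i (mod d_i)` (so `ν_i² + 1 ≡ 0`). If `(d₁, ν₁) ≠ (d₂, ν₂)`
then `|ν₂/d₂ - ν₁/d₁ - m| ≥ 1/(4 s₁ s₂)` for every integer `m`: writing
`ν/d = r/(sd) + k/s` with `(k, s) = 1` and `|r|/(sd) ≤ 1/(2s²) ≤ 3/(4 s₁ s₂)`, either the
`s₁s₂`-denominator part is a nonzero multiple of `1/(s₁s₂)`, or `s₁ = s₂`, `r₁ ≡ r₂ (mod s)`,
whence `r₁ = r₂`, `d₁ = d₂`, `ν₁ = ν₂` ("the points `ν/d` behave as if they repel each other").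
[cite: FriedlanderIwaniecAnnals1998, §3, the display before Lemma 3.2] -/
theorem root_spacing {d₁ d₂ ν₁ ν₂ : ℕ} {r₁ s₁ r₂ s₂ : ℤ}
    (h₁ : r₁ ^ 2 + s₁ ^ 2 = d₁) (h₂ : r₂ ^ 2 + s₂ ^ 2 = d₂)
    (hc₁ : IsCoprime r₁ s₁) (hc₂ : IsCoprime r₂ s₂) (hs₁ : 0 < s₁) (hs₂ : 0 < s₂)
    (hr₁ : |r₁| < s₁) (hr₂ : |r₂| < s₂) (hr₁0 : r₁ ≠ 0) (hr₂0 : r₂ ≠ 0)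
    (hsign : 0 < r₁ ↔ 0 < r₂) (hν₁ : (d₁ : ℤ) ∣ ν₁ * s₁ - r₁) (hν₂ : (d₂ : ℤ) ∣ ν₂ * s₂ - r₂)
    (hν₁d : ν₁ < d₁) (hν₂d : ν₂ < d₂) (h12 : 2 * s₁ ≤ 3 * s₂) (h21 : 2 * s₂ ≤ 3 * s₁)
    (hne : d₁ ≠ d₂ ∨ ν₁ ≠ ν₂) (m : ℤ) :
    1 / (4 * (s₁ : ℝ) * s₂) ≤ |(ν₂ : ℝ) / d₂ - ν₁ / d₁ - m| := by
  obtain ⟨k₁, hk₁⟩ := hν₁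
  obtain ⟨k₂, hk₂⟩ := hν₂
  have hks₁ : IsCoprime k₁ s₁ := isCoprime_of_rep h₁ hc₁ hk₁
  have hks₂ : IsCoprime k₂ s₂ := isCoprime_of_rep h₂ hc₂ hk₂
  have hd₁ : (0 : ℤ) < d₁ := by rw [← h₁]; nlinarith [sq_nonneg r₁]
  have hd₂ : (0 : ℤ) < d₂ := by rw [← h₂]; nlinarith [sq_nonneg r₂]
  -- real casts
  have hs₁R : (0 : ℝ) < s₁ := by exact_mod_cast hs₁
  have hs₂R : (0 : ℝ) < s₂ := by exact_mod_cast hs₂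
  have hd₁R : (0 : ℝ) < d₁ := by exact_mod_cast hd₁
  have hd₂R : (0 : ℝ) < d₂ := by exact_mod_cast hd₂
  have hk₁R : (ν₁ : ℝ) * s₁ - r₁ = d₁ * k₁ := by exact_mod_cast hk₁
  have hk₂R : (ν₂ : ℝ) * s₂ - r₂ = d₂ * k₂ := by exact_mod_cast hk₂
  -- the decomposition `Δ = ε + K/(s₁ s₂)`
  set K : ℤ := k₂ * s₁ - k₁ * s₂ - m * s₁ * s₂ with hK
  have hΔ : (ν₂ : ℝ) / d₂ - ν₁ / d₁ - m =
      ((r₂ : ℝ) / (s₂ * d₂) - r₁ / (s₁ * d₁)) + (K : ℝ) / (s₁ * s₂) := by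
    rw [hK]; push_cast
    field_simp
    linear_combination (s₁ : ℝ) * d₁ * hk₂R - (s₂ : ℝ) * d₂ * hk₁R
  -- the small parts: `|r_i|/(s_i d_i) ≤ 3/(4 s₁ s₂)`
  have hB : (0 : ℝ) < 4 * s₁ * s₂ := by positivity
  have hsmall₁ : |(r₁ : ℝ) / (s₁ * d₁)| ≤ 3 / (4 * s₁ * s₂) := by
    have hz : 4 * |r₁| * s₂ ≤ 3 * (r₁ ^ 2 + s₁ ^ 2) := by
      nlinarith [mul_le_mul_of_nonneg_left h21 (by positivity : (0 : ℤ) ≤ 2 * |r₁|),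
        sq_nonneg (|r₁| - s₁), sq_abs r₁, abs_nonneg r₁]
    have hzR : 4 * |(r₁ : ℝ)| * s₂ ≤ 3 * (d₁ : ℝ) := by
      have : ((4 * |r₁| * s₂ : ℤ) : ℝ) ≤ ((3 * (r₁ ^ 2 + s₁ ^ 2) : ℤ) : ℝ) := by exact_mod_cast hz
      rw [h₁] at this; push_cast at this; exact this
    rw [abs_div, abs_of_pos (by positivity : (0 : ℝ) < s₁ * d₁), div_le_div_iff₀ (by positivity) hB]
    nlinarith [hzR, hs₁R]
  have hsmall₂ : |(r₂ : ℝ) / (s₂ * d₂)| ≤ 3 / (4 * s₁ * s₂) := by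
    have hz : 4 * |r₂| * s₁ ≤ 3 * (r₂ ^ 2 + s₂ ^ 2) := by
      nlinarith [mul_le_mul_of_nonneg_left h12 (by positivity : (0 : ℤ) ≤ 2 * |r₂|),
        sq_nonneg (|r₂| - s₂), sq_abs r₂, abs_nonneg r₂]
    have hzR : 4 * |(r₂ : ℝ)| * s₁ ≤ 3 * (d₂ : ℝ) := by
      have : ((4 * |r₂| * s₁ : ℤ) : ℝ) ≤ ((3 * (r₂ ^ 2 + s₂ ^ 2) : ℤ) : ℝ) := by exact_mod_cast hz
      rw [h₂] at this; push_cast at this; exact this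
    rw [abs_div, abs_of_pos (by positivity : (0 : ℝ) < s₂ * d₂), div_le_div_iff₀ (by positivity) hB]
    nlinarith [hzR, hs₂R]
  -- same sign ⇒ `|ε| ≤ 3/(4 s₁ s₂)`
  have hε : |(r₂ : ℝ) / (s₂ * d₂) - r₁ / (s₁ * d₁)| ≤ 3 / (4 * s₁ * s₂) := by
    have e₁ := abs_le.mp hsmall₁
    have e₂ := abs_le.mp hsmall₂
    rw [abs_le]
    rcases lt_or_gt_of_ne hr₁0 with hneg | hpos
    · -- both negative
      have hr₂neg : r₂ < 0 := by
        by_contra h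
        have h' : 0 ≤ r₂ := not_lt.mp h
        rcases h'.lt_or_eq with h'' | h''
        · exact absurd (hsign.mpr h'') (by omega)
        · exact hr₂0 h''.symm
      have x1 : (r₁ : ℝ) / (s₁ * d₁) < 0 := div_neg_of_neg_of_pos (by exact_mod_cast hneg) (by positivity)
      have x2 : (r₂ : ℝ) / (s₂ * d₂) < 0 := div_neg_of_neg_of_pos (by exact_mod_cast hr₂neg) (by positivity)
      constructor <;> linarith [e₁.1, e₂.1]
    · have hr₂pos : 0 < r₂ := hsign.mp hpos
      have x1 : 0 < (r₁ : ℝ) / (s₁ * d₁) := div_pos (by exact_mod_cast hpos) (by positivity)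
      have x2 : 0 < (r₂ : ℝ) / (s₂ * d₂) := div_pos (by exact_mod_cast hr₂pos) (by positivity)
      constructor <;> linarith [e₁.2, e₂.2]
  rw [hΔ]
  by_cases hK0 : K ≠ 0
  · -- `|K| ≥ 1`
    have hK1 : (1 : ℝ) ≤ |(K : ℝ)| := by
      have : (1 : ℤ) ≤ |K| := Int.one_le_abs hK0
      exact_mod_cast this
    have hKs : 1 / ((s₁ : ℝ) * s₂) ≤ |(K : ℝ) / (s₁ * s₂)| := by
      rw [abs_div, abs_of_pos (by positivity : (0 : ℝ) < s₁ * s₂)]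
      exact div_le_div_of_nonneg_right hK1 (by positivity)
    have htri := abs_sub_abs_le_abs_sub ((K : ℝ) / (s₁ * s₂)) (-((r₂ : ℝ) / (s₂ * d₂) - r₁ / (s₁ * d₁)))
    rw [abs_neg, sub_neg_eq_add, add_comm] at htri
    have : 1 / ((s₁ : ℝ) * s₂) - 3 / (4 * s₁ * s₂) = 1 / (4 * s₁ * s₂) := by
      field_simp; ring
    linarith
  · -- `K = 0`: then the two points coincide
    exfalso
    rw [not_ne_iff] at hK0
    -- `s₁ ∣ s₂` and `s₂ ∣ s₁`
    have hs12 : s₁ ∣ s₂ := by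
      have : s₁ ∣ k₁ * s₂ := ⟨k₂ - m * s₂, by linear_combination -hK0⟩
      exact hks₁.symm.dvd_of_dvd_mul_left this
    have hs21 : s₂ ∣ s₁ := by
      have : s₂ ∣ k₂ * s₁ := ⟨k₁ + m * s₁, by linear_combination hK0⟩
      exact hks₂.symm.dvd_of_dvd_mul_left this
    have hss : s₁ = s₂ := Int.dvd_antisymm hs₁.le hs₂.le hs12 hs21
    subst hss
    -- `k₂ - k₁ = m s₁`
    have hkk : k₂ - k₁ = m * s₁ := by
      have : (k₂ - k₁) * s₁ = (m * s₁) * s₁ := by linear_combination hK0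
      exact mul_right_cancel₀ hs₁.ne' this
    -- `s₁ ∣ r₁ - r₂`
    have hkr₁ : s₁ ∣ k₁ * r₁ + 1 := by
      obtain ⟨u, v, huv⟩ := hks₁
      -- from `isCoprime_of_rep`'s proof: redo directly
      have h1 : r₁ * (k₁ * r₁ + 1) = s₁ * (ν₁ - k₁ * s₁) := by
        have : (d₁ : ℤ) = r₁ ^ 2 + s₁ ^ 2 := h₁.symm
        rw [this] at hk₁; linear_combination -hk₁
      exact hc₁.symm.dvd_of_dvd_mul_left ⟨_, h1⟩
    have hkr₂ : s₁ ∣ k₂ * r₂ + 1 := by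
      have h1 : r₂ * (k₂ * r₂ + 1) = s₁ * (ν₂ - k₂ * s₁) := by
        have : (d₂ : ℤ) = r₂ ^ 2 + s₁ ^ 2 := h₂.symm
        rw [this] at hk₂; linear_combination -hk₂
      exact hc₂.symm.dvd_of_dvd_mul_left ⟨_, h1⟩
    have hrr : s₁ ∣ r₁ - r₂ := by
      have h3 : s₁ ∣ k₁ * (r₁ - r₂) := by
        have := (hkr₁.sub hkr₂)
        -- `k₁ r₁ + 1 - (k₂ r₂ + 1) = k₁ (r₁ - r₂) - m s₁ r₂`
        have e : k₁ * r₁ + 1 - (k₂ * r₂ + 1) = k₁ * (r₁ - r₂) - (m * r₂) * s₁ := by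
          linear_combination -(r₂ * hkk)
        rw [e] at this
        exact (dvd_sub_left (dvd_mul_left _ _)).mp this  -- name?
      exact hks₁.symm.dvd_of_dvd_mul_left h3
    -- `|r₁ - r₂| < s₁` (same sign, both in `(-s₁, s₁)`), hence `r₁ = r₂`
    have hr12 : r₁ = r₂ := by
      have habs : |r₁ - r₂| < s₁ := by
        have a1 := abs_lt.mp hr₁
        have a2 := abs_lt.mp hr₂
        rw [abs_lt]
        rcases lt_or_gt_of_ne hr₁0 with hneg | hpos
        · have : r₂ < 0 := by
            by_contra h
            rcases (not_lt.mp h).lt_or_eq with h'' | h''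
            · exact absurd (hsign.mpr h'') (by omega)
            · exact hr₂0 h''.symm
          constructor <;> omega
        · have := hsign.mp hpos
          constructor <;> omega
      have := Int.eq_zero_of_abs_lt_dvd hrr habs
      omega
    subst hr12
    -- `d₁ = d₂`
    have hdd : d₁ = d₂ := by
      have : (d₁ : ℤ) = d₂ := by rw [← h₁, ← h₂]
      exact_mod_cast this
    subst hdd
    -- `ν₁ = ν₂`: `d ∣ (ν₁ - ν₂) s₁` and `(d, s₁) = 1`
    have hcds : IsCoprime (d₁ : ℤ) s₁ := by
      rw [← h₁, sq, sq, show r₁ * r₁ + s₁ * s₁ = r₁ * r₁ + s₁ * s₁ by rfl]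
      exact (hc₁.mul_left hc₁).add_mul_left_left s₁
    have hνν : (d₁ : ℤ) ∣ (ν₁ : ℤ) - ν₂ := by
      have : (d₁ : ℤ) ∣ ((ν₁ : ℤ) - ν₂) * s₁ :=
        ⟨k₁ - k₂, by linear_combination hk₁ - hk₂⟩
      exact hcds.dvd_of_dvd_mul_right this
    have hνeq : ν₁ = ν₂ := by
      have habs : |(ν₁ : ℤ) - ν₂| < d₁ := by
        rw [abs_lt]; constructor <;> omega
      have := Int.eq_zero_of_abs_lt_dvd hνν habs
      omega
    exact hne.elim (fun h => h rfl) (fun h => h hνeq)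

/-- The spacing within one class of moduli `D < d ≤ 2D`: if the representations attached to
two distinct roots have `r` of the same sign and `s` in the same range (`8s² ≤ 9D` for both or
for neither), the points are `1/(8D)`-spaced modulo `1` (`root_spacing` with `s₁ s₂ ≤ 2D`; the
ratio conditions `2s₁ ≤ 3s₂`, `2s₂ ≤ 3s₁` follow from `D < d ≤ 2s²`, `s² ≤ d ≤ 2D`).
[cite: FriedlanderIwaniecAnnals1998, §3, "if the moduli are confined to an interval ... the points ν/d are spaced by 1/4D"] -/
theorem root_spacing_class {D d₁ d₂ ν₁ ν₂ : ℕ} {r₁ s₁ r₂ s₂ : ℤ}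
    (h₁ : r₁ ^ 2 + s₁ ^ 2 = d₁) (h₂ : r₂ ^ 2 + s₂ ^ 2 = d₂)
    (hc₁ : IsCoprime r₁ s₁) (hc₂ : IsCoprime r₂ s₂) (hs₁ : 0 < s₁) (hs₂ : 0 < s₂)
    (hr₁ : |r₁| < s₁) (hr₂ : |r₂| < s₂) (hr₁0 : r₁ ≠ 0) (hr₂0 : r₂ ≠ 0)
    (hsign : 0 < r₁ ↔ 0 < r₂) (hν₁ : (d₁ : ℤ) ∣ ν₁ * s₁ - r₁) (hν₂ : (d₂ : ℤ) ∣ ν₂ * s₂ - r₂)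
    (hν₁d : ν₁ < d₁) (hν₂d : ν₂ < d₂) (hD₁ : D < d₁) (hD₁' : d₁ ≤ 2 * D) (hD₂ : D < d₂)
    (hD₂' : d₂ ≤ 2 * D) (hsize : 8 * s₁ ^ 2 ≤ 9 * D ↔ 8 * s₂ ^ 2 ≤ 9 * D)
    (hne : d₁ ≠ d₂ ∨ ν₁ ≠ ν₂) (m : ℤ) :
    1 / (8 * (D : ℝ)) ≤ |(ν₂ : ℝ) / d₂ - ν₁ / d₁ - m| := by
  -- size relations: `D < d ≤ 2 s²`, `s² ≤ d ≤ 2D`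
  have hsd₁ : s₁ ^ 2 ≤ 2 * (D : ℤ) := by
    have : s₁ ^ 2 ≤ (d₁ : ℤ) := by rw [← h₁]; exact le_add_of_nonneg_left (sq_nonneg _)
    have h' : (d₁ : ℤ) ≤ 2 * D := by exact_mod_cast hD₁'
    linarith
  have hsd₂ : s₂ ^ 2 ≤ 2 * (D : ℤ) := by
    have : s₂ ^ 2 ≤ (d₂ : ℤ) := by rw [← h₂]; exact le_add_of_nonneg_left (sq_nonneg _)
    have h' : (d₂ : ℤ) ≤ 2 * D := by exact_mod_cast hD₂'
    linarith
  have hDs₁ : (D : ℤ) < 2 * s₁ ^ 2 := by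
    have h' : (D : ℤ) < d₁ := by exact_mod_cast hD₁
    have hr2 : r₁ ^ 2 < s₁ ^ 2 := sq_lt_sq' (abs_lt.mp hr₁).1 (abs_lt.mp hr₁).2
    rw [← h₁] at h'; linarith
  have hDs₂ : (D : ℤ) < 2 * s₂ ^ 2 := by
    have h' : (D : ℤ) < d₂ := by exact_mod_cast hD₂
    have hr2 : r₂ ^ 2 < s₂ ^ 2 := sq_lt_sq' (abs_lt.mp hr₂).1 (abs_lt.mp hr₂).2
    rw [← h₂] at h'; linarith
  have hD0 : 0 < D := by
    have : 0 < 2 * s₁ ^ 2 := by positivity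
    have : s₁ ^ 2 ≤ 2 * (D : ℤ) := hsd₁
    by_contra h
    have : D = 0 := by omega
    subst this
    simp at hsd₁
    exact hs₁.ne' hsd₁
  -- ratio conditions from the common size class
  have hratio : 2 * s₁ ≤ 3 * s₂ ∧ 2 * s₂ ≤ 3 * s₁ := by
    by_cases hsm : 8 * s₁ ^ 2 ≤ 9 * (D : ℤ)
    · have hsm' : 8 * s₂ ^ 2 ≤ 9 * (D : ℤ) := hsize.mp hsm
      -- `4 s_i² < 9 s_j²`
      have a1 : (2 * s₁) ^ 2 < (3 * s₂) ^ 2 := by linarith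
      have a2 : (2 * s₂) ^ 2 < (3 * s₁) ^ 2 := by linarith
      exact ⟨(lt_of_pow_lt_pow_left₀ 2 (by positivity) a1).le,
        (lt_of_pow_lt_pow_left₀ 2 (by positivity) a2).le⟩
    · have hsm' : ¬ 8 * s₂ ^ 2 ≤ 9 * (D : ℤ) := fun h => hsm (hsize.mpr h)
      rw [not_le] at hsm hsm'
      -- `9 s_i² ≤ 18 D < 16 s_j²`
      have a1 : (3 * s₁) ^ 2 < (4 * s₂) ^ 2 := by linarith
      have a2 : (3 * s₂) ^ 2 < (4 * s₁) ^ 2 := by linarith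
      have b1 := lt_of_pow_lt_pow_left₀ 2 (by positivity) a1
      have b2 := lt_of_pow_lt_pow_left₀ 2 (by positivity) a2
      constructor <;> linarith
  have hsp := root_spacing h₁ h₂ hc₁ hc₂ hs₁ hs₂ hr₁ hr₂ hr₁0 hr₂0 hsign hν₁ hν₂ hν₁d hν₂d
    hratio.1 hratio.2 hne m
  -- `1/(8D) ≤ 1/(4 s₁ s₂)` as `s₁ s₂ ≤ 2D`
  have hss : s₁ * s₂ ≤ 2 * (D : ℤ) := by nlinarith [sq_nonneg (s₁ - s₂)]
  have hssR : (s₁ : ℝ) * s₂ ≤ 2 * D := by exact_mod_cast hss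
  have hs₁R : (0 : ℝ) < s₁ := by exact_mod_cast hs₁
  have hs₂R : (0 : ℝ) < s₂ := by exact_mod_cast hs₂
  have hDR : (0 : ℝ) < D := by exact_mod_cast hD0
  calc 1 / (8 * (D : ℝ)) ≤ 1 / (4 * (s₁ : ℝ) * s₂) := by
        rw [div_le_div_iff₀ (by positivity) (by positivity)]
        nlinarith
    _ ≤ _ := hsp

/-! ### Lemma 3.2: the large sieve at the roots -/

/-- **FI Lemma 3.2** (large sieve inequality at the roots of `ν² + 1 ≡ 0 (mod d)`, explicit
constant): for any complex `a_n` supported on an interval of length `N` and every `D`,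
`Σ_{D < d ≤ 2D} Σ_{ν² + 1 ≡ 0 (mod d)} |Σ_n a_n e(νn/d)|² ≤ 68 (D + N) Σ_n |a_n|²`
("`≪ (D + N)‖α‖²` ... the implied constant is absolute"). Proof as in FI: attach to each root a
primitive representation `d = r² + s²`, `ν s ≡ r (mod d)`, `0 < |r| < s`
(`exists_primitive_rep`); within each of the four classes {sign of `r`} × {`8s² ≤ 9D` or not}
the points `ν/d` are `1/(8D)`-spaced (`root_spacing`, as `s₁s₂ ≤ 2D`), and the large sieve
inequality for well-spaced points (`Literature.NumberTheory.Sieve.LargeSieve.largeSieve_wellSpaced`, Davenport–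
Halberstam/Bombieri, constant `N + 1 + 2δ⁻¹`) applies to each class. (`D ≤ 1` is trivial.)
[cite: FriedlanderIwaniecAnnals1998, Lemma 3.2] -/
theorem largeSieve_quadraticRoots (a : ℤ → ℂ) (M₀ : ℤ) (N D : ℕ) :
    ∑ d ∈ Ioc D (2 * D), ∑ ν ∈ range d with d ∣ ν ^ 2 + 1,
        ‖∑ n ∈ Ioc M₀ (M₀ + N), a n * (𝐞 ((ν : ℝ) * n / d) : ℂ)‖ ^ 2 ≤
      68 * ((D : ℝ) + N) * ∑ n ∈ Ioc M₀ (M₀ + N), ‖a n‖ ^ 2 := by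
  classical
  set A := ∑ n ∈ Ioc M₀ (M₀ + N), ‖a n‖ ^ 2 with hA
  have hA0 : 0 ≤ A := sum_nonneg fun _ _ => by positivity
  set R : Finset ((_ : ℕ) × ℕ) :=
    (Ioc D (2 * D)).sigma fun d => (range d).filter fun ν => d ∣ ν ^ 2 + 1 with hR
  set x : ((_ : ℕ) × ℕ) → ℝ := fun p => (p.2 : ℝ) / p.1 with hx
  -- it suffices to bound the sum over the sigma-set `R` with the phases `e(n x_p)`
  suffices h : ∑ p ∈ R, ‖∑ n ∈ Ioc M₀ (M₀ + N), a n * e (n * x p)‖ ^ 2 ≤ 68 * ((D : ℝ) + N) * A by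
    rw [hR, sum_sigma] at h
    simp only [hx] at h
    convert h using 4 with d _ ν _
    refine congr_arg _ (sum_congr rfl fun n _ => ?_)
    simp only [e]; congr 3; ring
  rcases Nat.lt_or_ge D 2 with hD2 | hD2
  · interval_cases D
    · -- `D = 0`: no moduli
      have hR0 : R = ∅ := by
        rw [hR]; ext p; simp
      rw [hR0, sum_empty]
      positivity
    · -- `D = 1`: the single point `(d, ν) = (2, 1)`
      have hR1 : ∀ p ∈ R, ∀ q ∈ R, p = q := by
        have hmem : ∀ p ∈ R, p = ⟨2, 1⟩ := by
          rintro ⟨d, ν⟩ hp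
          simp only [hR, mem_sigma, mem_Ioc, mem_filter, mem_range] at hp
          obtain ⟨⟨hd1, hd2⟩, hν, hdvd⟩ := hp
          have hd : d = 2 := by omega
          subst hd
          interval_cases ν
          · norm_num at hdvd
          · rfl
        intro p hp q hq
        rw [hmem p hp, hmem q hq]
      have hsep : ∀ p ∈ R, ∀ q ∈ R, p ≠ q → ∀ k : ℤ, (1 : ℝ) ≤ |x q - x p - k| :=
        fun p hp q hq hpq => absurd (hR1 p hp q hq) hpq
      refine (largeSieve_wellSpaced R x one_pos hsep a M₀ N).trans ?_
      rw [← hA]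
      refine mul_le_mul_of_nonneg_right ?_ hA0
      push_cast
      linarith [(Nat.cast_nonneg N : (0 : ℝ) ≤ N)]
  -- `D ≥ 2`: every modulus is `≥ 3`
  have hDR : (0 : ℝ) < D := by exact_mod_cast (show 0 < D by omega)
  -- a primitive representation attached to each root
  have hrep : ∀ p ∈ R, ∃ rs : ℤ × ℤ, rs.1 ^ 2 + rs.2 ^ 2 = (p.1 : ℕ) ∧ IsCoprime rs.1 rs.2 ∧
      0 < rs.2 ∧ |rs.1| < rs.2 ∧ rs.1 ≠ 0 ∧ ((p.1 : ℕ) : ℤ) ∣ (p.2 : ℤ) * rs.2 - rs.1 := by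
    rintro ⟨d, ν⟩ hp
    simp only [hR, mem_sigma, mem_Ioc, mem_filter, mem_range] at hp
    obtain ⟨⟨hd1, -⟩, -, hdvd⟩ := hp
    have hd3 : 3 ≤ d := by omega
    have hdvd' : (d : ℤ) ∣ (ν : ℤ) ^ 2 + 1 := by exact_mod_cast hdvd
    obtain ⟨r, s, h⟩ := exists_primitive_rep hd3 hdvd'
    exact ⟨(r, s), h⟩
  choose! rep hrep using hrep
  -- membership facts
  have hmemR : ∀ p ∈ R, D < p.1 ∧ p.1 ≤ 2 * D ∧ p.2 < p.1 := by
    rintro ⟨d, ν⟩ hp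
    simp only [hR, mem_sigma, mem_Ioc, mem_filter, mem_range] at hp
    exact ⟨hp.1.1, hp.1.2, hp.2.1⟩
  -- the four classes: sign of `r` and size of `s`
  set cls : ((_ : ℕ) × ℕ) → Bool × Bool := fun p =>
    (decide (0 < (rep p).1), decide (8 * (rep p).2 ^ 2 ≤ 9 * D)) with hcls
  -- within a class the points are `1/(8D)`-spaced
  have hδ : (0 : ℝ) < 1 / (8 * D) := by positivity
  have hsep : ∀ c : Bool × Bool, ∀ p ∈ R.filter (fun p => cls p = c), ∀ q ∈ R.filter (fun p => cls p = c),
      p ≠ q → ∀ k : ℤ, 1 / (8 * (D : ℝ)) ≤ |x q - x p - k| := by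
    intro c p hp q hq hpq k
    obtain ⟨hpR, hpc⟩ := mem_filter.mp hp
    obtain ⟨hqR, hqc⟩ := mem_filter.mp hq
    obtain ⟨h₁, hc₁, hs₁, hr₁, hr₁0, hν₁⟩ := hrep p hpR
    obtain ⟨h₂, hc₂, hs₂, hr₂, hr₂0, hν₂⟩ := hrep q hqR
    obtain ⟨hDp, hp2D, hνp⟩ := hmemR p hpR
    obtain ⟨hDq, hq2D, hνq⟩ := hmemR q hqR
    have hcc : cls p = cls q := hpc.trans hqc.symm
    simp only [hcls, Prod.mk.injEq, decide_eq_decide] at hcc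
    have hne : p.1 ≠ q.1 ∨ p.2 ≠ q.2 := by
      by_contra h
      simp only [not_or, not_ne_iff] at h
      exact hpq (Sigma.ext h.1 (heq_of_eq h.2))
    have hsize : 8 * (rep p).2 ^ 2 ≤ 9 * (D : ℤ) ↔ 8 * (rep q).2 ^ 2 ≤ 9 * (D : ℤ) := hcc.2
    simpa only [hx] using root_spacing_class h₁ h₂ hc₁ hc₂ hs₁ hs₂ hr₁ hr₂ hr₁0 hr₂0 hcc.1 hν₁ hν₂
      hνp hνq hDp hp2D hDq hq2D hsize hne k
  -- the large sieve on each class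
  have hclass : ∀ c : Bool × Bool,
      ∑ p ∈ R.filter (fun p => cls p = c), ‖∑ n ∈ Ioc M₀ (M₀ + N), a n * e (n * x p)‖ ^ 2 ≤
        ((N : ℝ) + 1 + 2 / (1 / (8 * D))) * A :=
    fun c => largeSieve_wellSpaced _ x hδ (hsep c) a M₀ N
  -- add up the four classes
  have hsplit : ∑ p ∈ R, ‖∑ n ∈ Ioc M₀ (M₀ + N), a n * e (n * x p)‖ ^ 2 =
      ∑ c ∈ (univ : Finset (Bool × Bool)),
        ∑ p ∈ R.filter (fun p => cls p = c), ‖∑ n ∈ Ioc M₀ (M₀ + N), a n * e (n * x p)‖ ^ 2 :=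
    (sum_fiberwise_of_maps_to (fun p _ => mem_univ (cls p)) _).symm
  rw [hsplit]
  calc ∑ c ∈ (univ : Finset (Bool × Bool)),
        ∑ p ∈ R.filter (fun p => cls p = c), ‖∑ n ∈ Ioc M₀ (M₀ + N), a n * e (n * x p)‖ ^ 2
      ≤ ∑ c ∈ (univ : Finset (Bool × Bool)), ((N : ℝ) + 1 + 2 / (1 / (8 * D))) * A :=
        sum_le_sum fun c _ => hclass c
    _ = 4 * (((N : ℝ) + 1 + 16 * D) * A) := by
        rw [sum_const, Finset.card_univ, Fintype.card_prod, Fintype.card_bool, nsmul_eq_mul]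
        push_cast
        congr 1
        field_simp
        ring
    _ ≤ 68 * ((D : ℝ) + N) * A := by
        have hD1 : (1 : ℝ) ≤ D := by exact_mod_cast (show 1 ≤ D by omega)
        have : 4 * ((N : ℝ) + 1 + 16 * D) ≤ 68 * ((D : ℝ) + N) := by
          nlinarith [(Nat.cast_nonneg N : (0 : ℝ) ≤ N)]
        calc 4 * (((N : ℝ) + 1 + 16 * D) * A) = (4 * ((N : ℝ) + 1 + 16 * D)) * A := by ring
          _ ≤ 68 * ((D : ℝ) + N) * A := mul_le_mul_of_nonneg_right this hA0

end Literature.NumberTheory.Sieve.FriedlanderIwaniecPrimes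

namespace Literature.NumberTheory.Sieve.FriedlanderIwaniecPrimes

open LargeSieve

/-! ### Counting the roots: `Σ_{d ≤ X} ρ(d) ≤ 11 X` -/

/-- A primitive representation determines the root: if `d_i = r² + s²`, `(r, s) = 1`,
`ν_i s ≡ r (mod d_i)`, `0 ≤ ν_i < d_i` (`i = 1, 2`), then `(d₁, ν₁) = (d₂, ν₂)`
("each such representation gives the unique root defined by `νs ≡ r (mod d)`").
[cite: FriedlanderIwaniecAnnals1998, §3, before Lemma 3.2] -/
theorem eq_of_rep_eq {d₁ d₂ ν₁ ν₂ : ℕ} {r s : ℤ} (h₁ : r ^ 2 + s ^ 2 = d₁) (h₂ : r ^ 2 + s ^ 2 = d₂)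
    (hc : IsCoprime r s) (hν₁ : (d₁ : ℤ) ∣ ν₁ * s - r) (hν₂ : (d₂ : ℤ) ∣ ν₂ * s - r)
    (hν₁d : ν₁ < d₁) (hν₂d : ν₂ < d₂) : d₁ = d₂ ∧ ν₁ = ν₂ := by
  have hdd : d₁ = d₂ := by
    have : (d₁ : ℤ) = d₂ := by rw [← h₁, ← h₂]
    exact_mod_cast this
  subst hdd
  refine ⟨rfl, ?_⟩
  have hcds : IsCoprime (d₁ : ℤ) s := by
    rw [← h₁, sq, sq]
    exact (hc.mul_left hc).add_mul_left_left s
  obtain ⟨k₁, hk₁⟩ := hν₁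
  obtain ⟨k₂, hk₂⟩ := hν₂
  have hνν : (d₁ : ℤ) ∣ (ν₁ : ℤ) - ν₂ := by
    have : (d₁ : ℤ) ∣ ((ν₁ : ℤ) - ν₂) * s := ⟨k₁ - k₂, by linear_combination hk₁ - hk₂⟩
    exact hcds.dvd_of_dvd_mul_right this
  have habs : |(ν₁ : ℤ) - ν₂| < d₁ := by
    rw [abs_lt]; constructor <;> omega
  have := Int.eq_zero_of_abs_lt_dvd hνν habs
  omega

/-- **The number of roots with `d ≤ X` is `O(X)`**: `#{(d, ν) : 1 ≤ d ≤ X, ν² + 1 ≡ 0 (mod d)} ≤ 11X`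
(i.e. `Σ_{d ≤ X} ρ(d) ≤ 11 X`), by the injection `(d, ν) ↦ (r, s)` into the box `|r|, |s| ≤ √X`
(`exists_primitive_rep`, `eq_of_rep_eq`) for `d ≥ 3`, plus the two points with `d ≤ 2`.
[cite: FriedlanderIwaniecAnnals1998, §3, "Σ_{d≤x} ρ(d) d⁻¹ ≪ log x" and the correspondence roots ↔ representations] -/
theorem card_sigma_roots_le (X : ℕ) :
    #((Ioc 0 X).sigma fun d => (range d).filter fun ν => d ∣ ν ^ 2 + 1) ≤ 11 * X := by
  classical
  rcases Nat.eq_zero_or_pos X with rfl | hX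
  · simp
  set P := (Ioc 0 X).sigma fun d => (range d).filter fun ν => d ∣ ν ^ 2 + 1 with hP
  set m := Nat.sqrt X with hm
  -- split according to `d ≤ 2`
  have hsplit : #P = #(P.filter fun p => p.1 ≤ 2) + #(P.filter fun p => ¬ p.1 ≤ 2) :=
    (card_filter_add_card_filter_not _).symm
  -- the small moduli contribute at most the two points `(1, 0)`, `(2, 1)`
  have hsmall : #(P.filter fun p => p.1 ≤ 2) ≤ 2 := by
    have hsub : (P.filter fun p => p.1 ≤ 2) ⊆ ({⟨1, 0⟩, ⟨2, 1⟩} : Finset ((_ : ℕ) × ℕ)) := by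
      rintro ⟨d, ν⟩ hp
      simp only [hP, mem_filter, mem_sigma, mem_Ioc, mem_range] at hp
      obtain ⟨⟨⟨hd0, -⟩, hν, hdvd⟩, hd2⟩ := hp
      simp only [mem_insert, mem_singleton]
      interval_cases d
      · left; interval_cases ν; rfl
      · right; interval_cases ν
        · norm_num at hdvd
        · rfl
    exact (card_le_card hsub).trans (card_le_two)
  -- the large moduli inject into the box
  have hlarge : #(P.filter fun p => ¬ p.1 ≤ 2) ≤ (2 * m + 1) ^ 2 := by
    set Q := P.filter fun p => ¬ p.1 ≤ 2 with hQ
    have hrep : ∀ p ∈ Q, ∃ rs : ℤ × ℤ, rs.1 ^ 2 + rs.2 ^ 2 = (p.1 : ℕ) ∧ IsCoprime rs.1 rs.2 ∧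
        0 < rs.2 ∧ |rs.1| < rs.2 ∧ rs.1 ≠ 0 ∧ ((p.1 : ℕ) : ℤ) ∣ (p.2 : ℤ) * rs.2 - rs.1 := by
      rintro ⟨d, ν⟩ hp
      simp only [hQ, hP, mem_filter, mem_sigma, mem_Ioc, mem_range, not_le] at hp
      obtain ⟨⟨-, -, hdvd⟩, hd2⟩ := hp
      have hdvd' : (d : ℤ) ∣ (ν : ℤ) ^ 2 + 1 := by exact_mod_cast hdvd
      obtain ⟨r, s, h⟩ := exists_primitive_rep (by omega) hdvd'
      exact ⟨(r, s), h⟩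
    choose! rep hrep using hrep
    have hbox : ∀ p ∈ Q, rep p ∈ Icc (-(m : ℤ)) m ×ˢ Icc (-(m : ℤ)) m := by
      intro p hp
      obtain ⟨h₁, -, hs, hr, -, -⟩ := hrep p hp
      have hpX : p.1 ≤ X := by
        have := (mem_filter.mp hp).1
        simp only [hP, mem_sigma, mem_Ioc] at this
        exact this.1.2
      have hd : (rep p).1 ^ 2 + (rep p).2 ^ 2 ≤ X := by
        rw [h₁]; exact_mod_cast hpX
      -- `|r|, s ≤ m`
      have hm1 : ((m + 1 : ℕ) : ℤ) ^ 2 > X := by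
        have h := Nat.lt_succ_sqrt X
        rw [← hm, Nat.succ_eq_add_one, ← sq] at h
        exact_mod_cast h
      have hs' : (rep p).2 ≤ m := by
        by_contra h
        have h' : (m : ℤ) + 1 ≤ (rep p).2 := by omega
        have : ((m : ℤ) + 1) ^ 2 ≤ (rep p).2 ^ 2 := pow_le_pow_left₀ (by positivity) h' 2
        push_cast at hm1
        nlinarith [sq_nonneg (rep p).1]
      have hr' : |(rep p).1| ≤ m := by linarith [hr.le]
      simp only [mem_product, mem_Icc]
      obtain ⟨hr1, hr2⟩ := abs_le.mp hr'
      exact ⟨⟨hr1, hr2⟩, by linarith, hs'⟩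
    have hinj : Set.InjOn rep ↑Q := by
      intro p hp q hq hpq
      obtain ⟨h₁, hc₁, -, -, -, hν₁⟩ := hrep p hp
      obtain ⟨h₂, -, -, -, -, hν₂⟩ := hrep q hq
      rw [hpq] at h₁ hν₁
      have hpd : p.2 < p.1 := by
        have := (mem_filter.mp hp).1
        simp only [hP, mem_sigma, mem_filter, mem_range] at this
        exact this.2.1
      have hqd : q.2 < q.1 := by
        have := (mem_filter.mp hq).1
        simp only [hP, mem_sigma, mem_filter, mem_range] at this
        exact this.2.1
      obtain ⟨-, hc₂, -⟩ := hrep q hq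
      obtain ⟨hd, hν⟩ := eq_of_rep_eq h₁ h₂ hc₂ hν₁ hν₂ hpd hqd
      exact Sigma.ext hd (heq_of_eq hν)
    calc #Q ≤ #(Icc (-(m : ℤ)) m ×ˢ Icc (-(m : ℤ)) m) := card_le_card_of_injOn rep hbox hinj
      _ = (2 * m + 1) ^ 2 := by
          rw [card_product, Int.card_Icc]
          have : ((m : ℤ) + 1 - -(m : ℤ)).toNat = 2 * m + 1 := by omega
          rw [this]; ring
  -- numerics: `(2m+1)² + 2 ≤ 11 X`
  have hm2 : m ^ 2 ≤ X := Nat.sqrt_le' X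
  have hmX : m ≤ X := Nat.sqrt_le_self X
  calc #P = _ := hsplit
    _ ≤ 2 + (2 * m + 1) ^ 2 := add_le_add hsmall hlarge
    _ ≤ 11 * X := by nlinarith

end Literature.NumberTheory.Sieve.FriedlanderIwaniecPrimes

namespace Literature.NumberTheory.Sieve.FriedlanderIwaniecPrimes

open LargeSieve

/-! ### (3.6): the first moment over all `d ≤ D` -/

/-- **FI (3.6)** (explicit constant): for all complex `a_n` on a window of length `N` and all `D`,
`Σ_{d ≤ D} Σ_{ν² + 1 ≡ 0 (mod d)} |Σ_n a_n e(νn/d)| ≤ 190 D^{1/2} (D + N)^{1/2} ‖a‖`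
("By Cauchy's inequality Lemma 3.2 yields (3.6) `≪ D^{1/2}(D + N)^{1/2}‖α‖`"): Cauchy's
inequality on each dyadic block `X/2 < d ≤ X`, using `#{(d, ν) : d ≤ X} ≤ 11X`
(`card_sigma_roots_le`) and Lemma 3.2 (`largeSieve_quadraticRoots`) on the two ranges
`(M, 2M]`, `(M+1, 2M+2]` (`M = ⌊X/2⌋`) covering the block, then summation of the geometric series
`Σ_j (X/2^j)^{1/2}` by induction (`134/√2 + 39 ≤ 134`); the modulus `d = 1` (root `ν = 0`) is
bounded directly by `N^{1/2}‖a‖`. [cite: FriedlanderIwaniecAnnals1998, (3.6)] -/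
theorem sum_roots_norm_le (a : ℤ → ℂ) (M₀ : ℤ) (N D : ℕ) :
    ∑ d ∈ Icc 1 D, ∑ ν ∈ range d with d ∣ ν ^ 2 + 1,
        ‖∑ n ∈ Ioc M₀ (M₀ + N), a n * (𝐞 ((ν : ℝ) * n / d) : ℂ)‖ ≤
      190 * Real.sqrt D * Real.sqrt (D + N) * Real.sqrt (∑ n ∈ Ioc M₀ (M₀ + N), ‖a n‖ ^ 2) := by
  classical
  set A := ∑ n ∈ Ioc M₀ (M₀ + N), ‖a n‖ ^ 2 with hA
  have hA0 : 0 ≤ A := sum_nonneg fun _ _ => by positivity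
  set f : ((_ : ℕ) × ℕ) → ℝ := fun p =>
    ‖∑ n ∈ Ioc M₀ (M₀ + N), a n * (𝐞 ((p.2 : ℝ) * n / p.1) : ℂ)‖ with hf
  set roots : ℕ → Finset ℕ := fun d => (range d).filter fun ν => d ∣ ν ^ 2 + 1 with hroots
  have hf0 : ∀ p, 0 ≤ f p := fun p => norm_nonneg _
  have hIcc : ∀ n : ℕ, Icc 1 n = Ioc 0 n := by
    intro n; ext d; simp [Nat.one_le_iff_ne_zero, Nat.pos_iff_ne_zero]
  -- Lemma 3.2 on a block
  have h32 : ∀ M : ℕ, ∑ d ∈ Ioc M (2 * M), ∑ ν ∈ roots d, f ⟨d, ν⟩ ^ 2 ≤ 68 * ((M : ℝ) + N) * A := by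
    intro M
    simpa only [hf, hroots, hA] using largeSieve_quadraticRoots a M₀ N M
  -- the modulus `d = 1`
  have h1 : ∑ ν ∈ roots 1, f ⟨1, ν⟩ ≤ Real.sqrt N * Real.sqrt A := by
    have hr1 : roots 1 = {0} := by
      rw [hroots]; ext ν; simp
    rw [hr1, sum_singleton]
    have hf1 : f ⟨1, 0⟩ = ‖∑ n ∈ Ioc M₀ (M₀ + N), a n‖ := by
      simp only [hf, Nat.cast_zero, zero_mul, Nat.cast_one, div_one]
      congr 1
      refine sum_congr rfl fun n _ => ?_
      simp
    rw [hf1]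
    have hCS := sum_mul_sq_le_sq_mul_sq (Ioc M₀ (M₀ + N)) (fun _ => (1 : ℝ)) (fun n => ‖a n‖)
    simp only [one_mul, one_pow, sum_const, nsmul_eq_mul, mul_one, Int.card_Ioc,
      show (M₀ + N - M₀).toNat = N by omega] at hCS
    have hS0 : 0 ≤ ∑ n ∈ Ioc M₀ (M₀ + N), ‖a n‖ := sum_nonneg fun _ _ => norm_nonneg _
    calc ‖∑ n ∈ Ioc M₀ (M₀ + N), a n‖ ≤ ∑ n ∈ Ioc M₀ (M₀ + N), ‖a n‖ := norm_sum_le _ _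
      _ ≤ Real.sqrt N * Real.sqrt A := by
          rw [← Real.sqrt_mul (Nat.cast_nonneg N), ← Real.sqrt_sq hS0]
          exact Real.sqrt_le_sqrt (by rw [hA]; exact hCS)
  -- the dyadic induction
  have key : ∀ X : ℕ, ∑ d ∈ Icc 1 X, ∑ ν ∈ roots d, f ⟨d, ν⟩ ≤
      134 * Real.sqrt X * Real.sqrt (X + N + 1) * Real.sqrt A := by
    intro X
    induction X using Nat.strong_induction_on with
    | _ X ih =>
    rcases Nat.lt_or_ge X 2 with hX2 | hX2
    · interval_cases X
      · simp
      · rw [Finset.Icc_self, sum_singleton]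
        refine h1.trans ?_
        have h2 : Real.sqrt N ≤ Real.sqrt ((1 : ℕ) + N + 1) := Real.sqrt_le_sqrt (by push_cast; linarith)
        have h3 : (1 : ℝ) ≤ 134 * Real.sqrt (1 : ℕ) := by simp
        calc Real.sqrt N * Real.sqrt A ≤ Real.sqrt ((1 : ℕ) + N + 1) * Real.sqrt A :=
              mul_le_mul_of_nonneg_right h2 (Real.sqrt_nonneg A)
          _ = 1 * (Real.sqrt ((1 : ℕ) + N + 1) * Real.sqrt A) := by ring
          _ ≤ (134 * Real.sqrt (1 : ℕ)) * (Real.sqrt ((1 : ℕ) + N + 1) * Real.sqrt A) :=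
              mul_le_mul_of_nonneg_right h3 (by positivity)
          _ = _ := by ring
    · set M := X / 2 with hM
      have hM1 : 1 ≤ M := by omega
      have hMX : M < X := by omega
      have hXM : X ≤ 2 * M + 1 := by omega
      have hM2X : M * 2 ≤ X := by omega
      -- split `Icc 1 X = Ioc 0 M ∪ Ioc M X`
      have hsplit : ∑ d ∈ Icc 1 X, ∑ ν ∈ roots d, f ⟨d, ν⟩ =
          ∑ d ∈ Icc 1 M, ∑ ν ∈ roots d, f ⟨d, ν⟩ + ∑ d ∈ Ioc M X, ∑ ν ∈ roots d, f ⟨d, ν⟩ := by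
        rw [hIcc, hIcc, sum_Ioc_consecutive _ (Nat.zero_le M) hMX.le]
      -- the top block: Cauchy–Schwarz over `Q`
      set Q := (Ioc M X).sigma roots with hQ
      have hQcard : (#Q : ℝ) ≤ 11 * X := by
        have h1' : Q ⊆ (Ioc 0 X).sigma roots :=
          sigma_mono (Ioc_subset_Ioc (Nat.zero_le M) le_rfl) fun _ => subset_rfl
        have h2' := card_sigma_roots_le X
        have := (card_le_card h1').trans h2'
        exact_mod_cast this
      have hG0 : ∀ d, 0 ≤ ∑ ν ∈ roots d, f ⟨d, ν⟩ ^ 2 := fun d => sum_nonneg fun _ _ => by positivity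
      have htopSq : ∑ p ∈ Q, f p ^ 2 ≤ 136 * ((X : ℝ) + N + 1) * A := by
        rw [hQ, sum_sigma]
        have hMR : (M : ℝ) ≤ X / 2 := by
          rw [le_div_iff₀ two_pos]; exact_mod_cast hM2X
        calc ∑ d ∈ Ioc M X, ∑ ν ∈ roots d, f ⟨d, ν⟩ ^ 2
            ≤ ∑ d ∈ Ioc M (2 * M + 2), ∑ ν ∈ roots d, f ⟨d, ν⟩ ^ 2 :=
              sum_le_sum_of_subset_of_nonneg (Ioc_subset_Ioc le_rfl (by omega)) fun d _ _ => hG0 d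
          _ = ∑ d ∈ Ioc M (2 * M), ∑ ν ∈ roots d, f ⟨d, ν⟩ ^ 2 +
                ∑ d ∈ Ioc (2 * M) (2 * M + 2), ∑ ν ∈ roots d, f ⟨d, ν⟩ ^ 2 :=
              (sum_Ioc_consecutive _ (by omega) (by omega)).symm
          _ ≤ 68 * ((M : ℝ) + N) * A +
                ∑ d ∈ Ioc (M + 1) (2 * (M + 1)), ∑ ν ∈ roots d, f ⟨d, ν⟩ ^ 2 :=
              add_le_add (h32 M) (sum_le_sum_of_subset_of_nonneg
                (Ioc_subset_Ioc (by omega) (by omega)) fun d _ _ => hG0 d)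
          _ ≤ 68 * ((M : ℝ) + N) * A + 68 * (((M + 1 : ℕ) : ℝ) + N) * A :=
              add_le_add_right (h32 (M + 1)) _
          _ ≤ 136 * ((X : ℝ) + N + 1) * A := by
              push_cast
              nlinarith [hA0]
      have htop : ∑ p ∈ Q, f p ≤ 39 * Real.sqrt X * Real.sqrt (X + N + 1) * Real.sqrt A := by
        have hCS := sum_mul_sq_le_sq_mul_sq Q (fun _ => (1 : ℝ)) f
        simp only [one_mul, one_pow, sum_const, nsmul_eq_mul, mul_one] at hCS
        have hS0 : 0 ≤ ∑ p ∈ Q, f p := sum_nonneg fun p _ => hf0 p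
        have hsq : (∑ p ∈ Q, f p) ^ 2 ≤
            (39 * Real.sqrt X * Real.sqrt (X + N + 1) * Real.sqrt A) ^ 2 := by
          have e : (39 * Real.sqrt X * Real.sqrt (X + N + 1) * Real.sqrt A) ^ 2 =
              1521 * X * ((X : ℝ) + N + 1) * A := by
            rw [mul_pow, mul_pow, mul_pow, Real.sq_sqrt (Nat.cast_nonneg _),
              Real.sq_sqrt (by positivity), Real.sq_sqrt hA0]
            ring
          rw [e]
          have hf2 : 0 ≤ ∑ p ∈ Q, f p ^ 2 := sum_nonneg fun _ _ => by positivity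
          calc (∑ p ∈ Q, f p) ^ 2 ≤ #Q * ∑ p ∈ Q, f p ^ 2 := hCS
            _ ≤ (11 * X) * (136 * ((X : ℝ) + N + 1) * A) :=
                mul_le_mul hQcard htopSq hf2 (by positivity)
            _ ≤ 1521 * X * ((X : ℝ) + N + 1) * A := by nlinarith [hA0]
        exact (pow_le_pow_iff_left₀ hS0 (by positivity) two_ne_zero).mp hsq
      -- combine with the induction hypothesis at `M = ⌊X/2⌋`
      have hih := ih M hMX
      have h2pos : 0 < Real.sqrt 2 := Real.sqrt_pos.mpr two_pos
      have hmono1 : Real.sqrt M ≤ Real.sqrt X / Real.sqrt 2 := by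
        rw [le_div_iff₀ h2pos, ← Real.sqrt_mul (Nat.cast_nonneg _)]
        exact Real.sqrt_le_sqrt (by exact_mod_cast hM2X)
      have hMXR : (M : ℝ) ≤ X := by exact_mod_cast hMX.le
      have hmono2 : Real.sqrt ((M : ℕ) + N + 1) ≤ Real.sqrt (X + N + 1) :=
        Real.sqrt_le_sqrt (by linarith)
      have hconst : (134 : ℝ) / Real.sqrt 2 + 39 ≤ 134 := by
        rw [div_add' _ _ _ h2pos.ne', div_le_iff₀ h2pos]
        nlinarith [Real.sq_sqrt (show (0 : ℝ) ≤ 2 by norm_num), Real.sqrt_nonneg 2]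
      have hB : 0 ≤ Real.sqrt X * Real.sqrt (X + N + 1) * Real.sqrt A := by positivity
      rw [hsplit]
      have hblock : ∑ d ∈ Ioc M X, ∑ ν ∈ roots d, f ⟨d, ν⟩ = ∑ p ∈ Q, f p := by
        rw [hQ, sum_sigma]
      rw [hblock]
      calc ∑ d ∈ Icc 1 M, ∑ ν ∈ roots d, f ⟨d, ν⟩ + ∑ p ∈ Q, f p
          ≤ 134 * Real.sqrt M * Real.sqrt ((M : ℕ) + N + 1) * Real.sqrt A +
              39 * Real.sqrt X * Real.sqrt (X + N + 1) * Real.sqrt A := add_le_add hih htop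
        _ ≤ 134 * (Real.sqrt X / Real.sqrt 2) * Real.sqrt (X + N + 1) * Real.sqrt A +
              39 * Real.sqrt X * Real.sqrt (X + N + 1) * Real.sqrt A := by
            gcongr
        _ = (134 / Real.sqrt 2 + 39) * (Real.sqrt X * Real.sqrt (X + N + 1) * Real.sqrt A) := by
            field_simp
        _ ≤ 134 * (Real.sqrt X * Real.sqrt (X + N + 1) * Real.sqrt A) :=
            mul_le_mul_of_nonneg_right hconst hB
        _ = 134 * Real.sqrt X * Real.sqrt (X + N + 1) * Real.sqrt A := by ring
  -- conclusion
  rcases Nat.eq_zero_or_pos D with rfl | hD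
  · simp
  · have hkey := key D
    simp only [hf, hroots] at hkey
    refine hkey.trans ?_
    have hD1 : (1 : ℝ) ≤ D := by exact_mod_cast hD
    have hs2 : Real.sqrt ((D : ℝ) + N + 1) ≤ Real.sqrt 2 * Real.sqrt (D + N) := by
      rw [← Real.sqrt_mul two_pos.le]
      exact Real.sqrt_le_sqrt (by linarith [(Nat.cast_nonneg N : (0 : ℝ) ≤ N)])
    have hc : 134 * Real.sqrt 2 ≤ 190 := by
      nlinarith [Real.sq_sqrt (show (0 : ℝ) ≤ 2 by norm_num), Real.sqrt_nonneg 2]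
    calc 134 * Real.sqrt D * Real.sqrt ((D : ℝ) + N + 1) * Real.sqrt A
        ≤ 134 * Real.sqrt D * (Real.sqrt 2 * Real.sqrt (D + N)) * Real.sqrt A := by gcongr
      _ = (134 * Real.sqrt 2) * Real.sqrt D * Real.sqrt (D + N) * Real.sqrt A := by ring
      _ ≤ 190 * Real.sqrt D * Real.sqrt (D + N) * Real.sqrt A := by gcongr

end Literature.NumberTheory.Sieve.FriedlanderIwaniecPrimes
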